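import Mathlib
import Literature.Analysis.FluidPDE.VectorCalculus
import Summits.NavierStokesRegularity.NavierStokesRegularity.Theses.UnthreadedRigidityDoor
import Summits.NavierStokesRegularity.NavierStokesRegularity.Theorems.ThreadingFluxPlatonicDefs
import Summits.NavierStokesRegularity.NavierStokesRegularity.Theorems.RigidMotionDoorRigidFlow
import Summits.NavierStokesRegularity.NavierStokesRegularity.Theorems.SymmetryModuliCountAxisymEndLiouvilleStubAxisNormalForm
import HarnessLib

/-!
# Crux `PoloidalLiouville` (stmt-NavierStokesRegularity-1222, W1) / `UnthreadedRigidity` (stmt-…-27585, W2), crux idea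
# «platonic-germ-sieve» (ns-idea-15 g11): (σ7) INFINITESIMAL ⇒ GLOBAL — the one axis of W2 integrates to a one-parameter
# rotation symmetry

Support file (Theorems-side; seat ns-wall-eng-8 g9, cell `ns-wall-extremal`, item (σ7) of eng-8 g8's record;
`--supports stmt-NavierStokesRegularity-1222 --as helper`; 0 kit).  Theorem-only.

W2 (`Theses.UnthreadedRigidityDoor.UnthreadedRigidity`) concludes that a window solution unthreaded about `x₀` is
INFINITESIMALLY axisymmetric: there is a skew `A ≠ 0` with `D(u t)(x)[A (x − x₀)] = A (u t x)` for all `x`.  This file reads that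
conclusion as an honest symmetry under the whole ONE-PARAMETER GROUP `{exp (s • A)}` about `x₀`, in the original coordinates:

* §1 (any real Banach space, any bounded `A`) `Platonic.apply_exp_smul_of_fderivOn_comm` — ORBIT form: if the orbit segment
  `s ↦ exp (s • A) x` stays in an open set `U` on which `W` is differentiable with `DW(y)[A y] = A (W y)`, then
  `W (exp (t • A) x) = exp (t • A) (W x)`; the function `s ↦ exp ((t − s) • A) (W (exp (s • A) x))` has zero derivative
  (`HasDerivAt.clm_apply`, `hasDerivAt_exp_smul_const`); no ODE uniqueness and no skewness are used.  Invariant-set and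
  global (`U = univ`) corollaries, and the converse at `t = 0` (`Platonic.fderiv_comm_of_apply_exp_smul`).
  The global statement for inner-product spaces is ALSO the case `c = e₂ = 0` of the tree's
  `RigidMotionDoorRigidFlow.apply_flow_eq_of_fderiv` (route RigidMotionDoor), which §3 uses BY NAME.  Nearest Literature:
  `Literature.RepresentationTheory.CompactGroups.map_exp_smul_of_comm` (LINEAR intertwiners) and the ODE engine
  `…CompactGroups.eq_exp_smul_apply_of_hasDerivAt` (`DerivationFlows`), not imported here (the non-linear `W` is direct).
* §2 (skew `A`: `⟪A x, x⟫ = 0`, W2's binder) `exp (s • A)` is norm- and inner-product-preserving (the tree's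
  `RigidMotionDoorRigidFlow.exp_smul_mem_unitary` + Mathlib), fixes `ker A` pointwise (`…exp_smul_apply_of_map_eq_zero`, by
  name), hence preserves every set `{y | ‖y‖ ∈ T}` — balls, spheres, shells, exteriors, the punctured space about the centre:
  the LOCAL forms `Platonic.apply_exp_smul_of_fderivOn_comm_of_norm_mem` / `Platonic.map_exp_smul_centre_of_fderivOn`.
* §3 W2's EXACT conclusion shape: `Platonic.map_exp_smul_centre_of_fderiv`
  (`Dφ(x)[A (x − x₀)] − A (φ x) = 0` ∀ `x` ⇒ `φ (x₀ + exp (s • A) (x − x₀)) = exp (s • A) (φ x)`), the by-name bridge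
  `Platonic.exists_isAxisymmetric_conj_of_fderiv` to the tree's integrated `IsAxisymmetric` in adapted coordinates
  (`exists_conj_eq_smul_rotGen`, `fderiv_normalised_rotGen`, `isAxisymmetric_of_fderiv_rotGen` of the `AxisymEndLiouville`
  line), and the HEADLINE `Platonic.exp_smul_equivariant_of_unthreadedRigidity`: `UnthreadedRigidity →` every window datum
  with differentiable slices is equivariant, at every time of the window, under a one-parameter group of linear isometries
  `exp (s • A)` about `x₀` fixing a non-zero axis vector `w` (`A w = 0`); and the card's forms
  `Platonic.isEquivariant_range_exp_smul_of_fderiv_comm` / `…_crossCLM_of_fderiv_cross` (`ThreadingFluxPlatonicDefs.IsEquivariant`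
  under `{exp (t • A)}`, resp. `{exp (t • (c × ·))}` for the axial form `DW(x)[c × x] = c × W(x)` of p722437).

HONEST LABEL: elementary calculus (flow of a linear vector field); information-grade glue strictly below W1/W2; TRUE as
typed (the headline is CONDITIONAL on `UnthreadedRigidity` by name, taken as a hypothesis).  `UnthreadedRigidity` (27585),
`PoloidalLiouville` (1222), `OctahedralCentreRigidity` and NS regularity are OPEN and NOT touched; W1/W2 movement 0.  [folklore]
-/

-- the summit and its single sub-problem share the name (CONVENTIONS §1)
set_option linter.dupNamespace false

noncomputable section

open Set Function Filter Metric
open scoped RealInnerProductSpace Topology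
open NormedSpace (exp)
open Literature.Analysis.FluidPDE
open Summit.NavierStokesRegularity.NavierStokesRegularity.Theorems.PoloidalLiouville.CentreJet (E3)
open Summit.NavierStokesRegularity.NavierStokesRegularity.Theorems.RigidMotionDoorRigidFlow
  (exp_smul_mem_unitary exp_smul_apply_of_map_eq_zero apply_flow_eq_of_fderiv)
open Summit.NavierStokesRegularity.NavierStokesRegularity.Theorems.AxisymEndLiouville.AbsorbingAxisSwirlExtinction
  (exists_conj_eq_smul_rotGen fderiv_normalised_rotGen isAxisymmetric_of_fderiv_rotGen exists_ne_zero_map_eq_zero_of_skew)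

namespace Summit.NavierStokesRegularity.NavierStokesRegularity.Theorems.PoloidalLiouville.Platonic

/-! ### §1 The one-parameter group `exp (s • A)` of a bounded operator: infinitesimal ⇔ global equivariance -/

section Flow

variable {E : Type*} [NormedAddCommGroup E] [NormedSpace ℝ E] [CompleteSpace E]

/-- **Transport along the linear flow, ORBIT form.**  `A` bounded on a real Banach space, `U` open, `W` differentiable on `U`
with `DW(y)[A y] = A (W y)` for `y ∈ U`; if the orbit segment `s ↦ exp (s • A) x`, `s` between `0` and `t`, stays in `U`, then
`W (exp (t • A) x) = exp (t • A) (W x)`.  Proof: `ψ s = exp ((t − s) • A) (W (exp (s • A) x))` has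
`ψ′ s = −exp((t−s)A) A W(y) + exp((t−s)A) DW(y)[A y] = 0` at `y = exp (s • A) x`, so `ψ t = ψ 0`. [folklore] -/
theorem apply_exp_smul_of_fderivOn_comm (A : E →L[ℝ] E) {U : Set E} (hU : IsOpen U) {W : E → E}
    (hW : DifferentiableOn ℝ W U) (hcomm : ∀ y ∈ U, fderiv ℝ W y (A y) = A (W y)) {t : ℝ} {x : E}
    (horb : ∀ s ∈ uIcc (0 : ℝ) t, exp (s • A) x ∈ U) :
    W (exp (t • A) x) = exp (t • A) (W x) := by
  have hd : ∀ s ∈ uIcc (0 : ℝ) t,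
      HasDerivAt (fun σ : ℝ => exp ((t - σ) • A) (W (exp (σ • A) x))) 0 s := by
    intro s hs
    have hy : exp (s • A) x ∈ U := horb s hs
    -- the orbit and `W` along it
    have hγ : HasDerivAt (fun σ : ℝ => exp (σ • A) x) (A (exp (s • A) x)) s := by
      simpa [mul_apply_eq_comp] using
        (hasDerivAt_exp_smul_const' (𝕂 := ℝ) A s).clm_apply (hasDerivAt_const s x)
    have hWγ : HasDerivAt (fun σ : ℝ => W (exp (σ • A) x)) (A (W (exp (s • A) x))) s := by
      have h := ((hW _ hy).differentiableAt (hU.mem_nhds hy)).hasFDerivAt.comp_hasDerivAt s hγ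
      rw [hcomm _ hy] at h
      exact h
    -- the outer factor `exp ((t - σ) • A)`
    have hG : HasDerivAt (fun σ : ℝ => exp ((t - σ) • A)) ((-1 : ℝ) • (exp ((t - s) • A) * A)) s :=
      (hasDerivAt_exp_smul_const (𝕂 := ℝ) A (t - s)).scomp s ((hasDerivAt_id s).const_sub t)
    refine (hG.clm_apply hWγ).congr_deriv ?_
    simp
  have hcont : ContinuousOn (fun σ : ℝ => exp ((t - σ) • A) (W (exp (σ • A) x))) (uIcc (0 : ℝ) t) :=
    fun s hs => (hd s hs).continuousAt.continuousWithinAt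
  have hconst := constant_of_has_deriv_right_zero hcont
    (fun s hs => (hd s (Ico_subset_Icc_self hs)).hasDerivWithinAt)
  have ht := hconst t right_mem_uIcc
  have h0 := hconst 0 left_mem_uIcc
  rw [← h0] at ht
  simpa using ht

/-- **INVARIANT-SET form.**  If the open set `U` is invariant under every `exp (s • A)` and `W` is differentiable on `U` with
`DW(y)[A y] = A (W y)` there, then `W (exp (t • A) x) = exp (t • A) (W x)` for all `x ∈ U` and all `t`. [folklore] -/
theorem apply_exp_smul_of_fderivOn_comm_of_mapsTo (A : E →L[ℝ] E) {U : Set E} (hU : IsOpen U)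
    (hinv : ∀ s : ℝ, MapsTo (fun y => exp (s • A) y) U U) {W : E → E} (hW : DifferentiableOn ℝ W U)
    (hcomm : ∀ y ∈ U, fderiv ℝ W y (A y) = A (W y)) {x : E} (hx : x ∈ U) (t : ℝ) :
    W (exp (t • A) x) = exp (t • A) (W x) :=
  apply_exp_smul_of_fderivOn_comm A hU hW hcomm fun s _ => hinv s hx

/-- **GLOBAL form** (infinitesimal ⇒ global): `W` differentiable with `DW(x)[A x] = A (W x)` for all `x` is equivariant under
the whole one-parameter group, `W (exp (t • A) x) = exp (t • A) (W x)` for all `t, x`.  (For inner-product spaces this is also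
`RigidMotionDoorRigidFlow.apply_flow_eq_of_fderiv` with `c = e₂ = 0`.) [folklore] -/
theorem apply_exp_smul_of_fderiv_comm (A : E →L[ℝ] E) {W : E → E} (hW : Differentiable ℝ W)
    (hcomm : ∀ y, fderiv ℝ W y (A y) = A (W y)) (t : ℝ) (x : E) :
    W (exp (t • A) x) = exp (t • A) (W x) :=
  apply_exp_smul_of_fderivOn_comm A isOpen_univ hW.differentiableOn (fun y _ => hcomm y) fun _ _ => mem_univ _

/-- **CONVERSE** (global ⇒ infinitesimal, at one point): if `W` is differentiable at `x` and
`W (exp (t • A) x) = exp (t • A) (W x)` for all `t`, then `DW(x)[A x] = A (W x)` (differentiate at `t = 0`). [folklore] -/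
theorem fderiv_comm_of_apply_exp_smul (A : E →L[ℝ] E) {W : E → E} {x : E} (hW : DifferentiableAt ℝ W x)
    (h : ∀ t : ℝ, W (exp (t • A) x) = exp (t • A) (W x)) : fderiv ℝ W x (A x) = A (W x) := by
  have hγ : HasDerivAt (fun σ : ℝ => exp (σ • A) x) (A x) 0 := by
    simpa [mul_apply_eq_comp] using
      (hasDerivAt_exp_smul_const' (𝕂 := ℝ) A 0).clm_apply (hasDerivAt_const (0 : ℝ) x)
  have hW' : HasFDerivAt W (fderiv ℝ W x) (exp ((0 : ℝ) • A) x) := by simpa using hW.hasFDerivAt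
  have h1 : HasDerivAt (fun σ : ℝ => W (exp (σ • A) x)) (fderiv ℝ W x (A x)) 0 := hW'.comp_hasDerivAt (0 : ℝ) hγ
  have h2 : HasDerivAt (fun σ : ℝ => exp (σ • A) (W x)) (A (W x)) 0 := by
    simpa [mul_apply_eq_comp] using
      (hasDerivAt_exp_smul_const' (𝕂 := ℝ) A 0).clm_apply (hasDerivAt_const (0 : ℝ) (W x))
  rw [show (fun σ : ℝ => W (exp (σ • A) x)) = fun σ => exp (σ • A) (W x) from funext h] at h1
  exact h1.unique h2

end Flow

/-! ### §2 Skew generators: `exp (s • A)` is a linear isometry fixing the axis, so the flow preserves balls and shells -/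

section Skew

variable {E : Type*} [NormedAddCommGroup E] [InnerProductSpace ℝ E] [CompleteSpace E]

/-- For skew `A` (`⟪A x, x⟫ = 0` for all `x` — W2's binder) every `exp (t • A)` preserves the norm
(`RigidMotionDoorRigidFlow.exp_smul_mem_unitary` + `ContinuousLinearMap.norm_map_of_mem_unitary`). [folklore] -/
theorem norm_exp_smul_apply_of_inner_self_eq_zero {A : E →L[ℝ] E} (hA : ∀ x, ⟪A x, x⟫ = 0) (t : ℝ) (x : E) :
    ‖exp (t • A) x‖ = ‖x‖ :=
  ContinuousLinearMap.norm_map_of_mem_unitary (exp_smul_mem_unitary hA t) x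

/-- … and inner products. [folklore] -/
theorem inner_exp_smul_apply_exp_smul_apply {A : E →L[ℝ] E} (hA : ∀ x, ⟪A x, x⟫ = 0) (t : ℝ) (x y : E) :
    ⟪exp (t • A) x, exp (t • A) y⟫ = ⟪x, y⟫ :=
  ContinuousLinearMap.inner_map_map_of_mem_unitary (exp_smul_mem_unitary hA t) x y

/-- The axial coordinate is preserved: `A a = 0` gives `⟪exp (t • A) x, a⟫ = ⟪x, a⟫` (the axis is fixed pointwise,
`RigidMotionDoorRigidFlow.exp_smul_apply_of_map_eq_zero`). [folklore] -/
theorem inner_exp_smul_apply_of_map_eq_zero {A : E →L[ℝ] E} (hA : ∀ x, ⟪A x, x⟫ = 0) {a : E} (ha : A a = 0)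
    (t : ℝ) (x : E) : ⟪exp (t • A) x, a⟫ = ⟪x, a⟫ := by
  conv_lhs => rw [← exp_smul_apply_of_map_eq_zero A ha t]
  exact inner_exp_smul_apply_exp_smul_apply hA t x a

/-- The flow of a skew generator preserves every set cut out by the norm, `{y | ‖y‖ ∈ T}`: balls (`T = Iio r`), spheres,
shells (`T = Ioo r R`), exteriors, the punctured space (`T = Ioi 0`). [folklore] -/
theorem exp_smul_mapsTo_norm_mem {A : E →L[ℝ] E} (hA : ∀ x, ⟪A x, x⟫ = 0) (t : ℝ) (T : Set ℝ) :
    MapsTo (fun y => exp (t • A) y) {y : E | ‖y‖ ∈ T} {y : E | ‖y‖ ∈ T} := fun y hy => by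
  simpa [norm_exp_smul_apply_of_inner_self_eq_zero hA] using hy

/-- In particular it preserves every ball about the centre. [folklore] -/
theorem exp_smul_mapsTo_ball {A : E →L[ℝ] E} (hA : ∀ x, ⟪A x, x⟫ = 0) (t r : ℝ) :
    MapsTo (fun y => exp (t • A) y) (ball (0 : E) r) (ball 0 r) := fun y hy => by
  simpa [norm_exp_smul_apply_of_inner_self_eq_zero hA] using hy

/-- **LOCAL form about the centre `0`** (skew `A`): `W` differentiable on the open set `{y | ‖y‖ ∈ T}` (`T ⊆ ℝ` open: a ball,
a shell, an exterior domain, the punctured space) with `DW(y)[A y] = A (W y)` there ⇒ `W (exp (t • A) x) = exp (t • A) (W x)` for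
`‖x‖ ∈ T` and all `t`. [folklore] -/
theorem apply_exp_smul_of_fderivOn_comm_of_norm_mem {A : E →L[ℝ] E} (hA : ∀ x, ⟪A x, x⟫ = 0) {T : Set ℝ}
    (hT : IsOpen T) {W : E → E} (hW : DifferentiableOn ℝ W {y : E | ‖y‖ ∈ T})
    (hcomm : ∀ y : E, ‖y‖ ∈ T → fderiv ℝ W y (A y) = A (W y)) {x : E} (hx : ‖x‖ ∈ T) (t : ℝ) :
    W (exp (t • A) x) = exp (t • A) (W x) :=
  apply_exp_smul_of_fderivOn_comm_of_mapsTo A (hT.preimage continuous_norm) (fun s => exp_smul_mapsTo_norm_mem hA s T)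
    hW (fun y hy => hcomm y hy) hx t

end Skew

/-! ### §3 W2's exact conclusion shape `Dφ(x)[A (x − x₀)] − A (φ x) = 0`: equivariance under `{exp (s • A)}` about `x₀` -/

section Centre

variable {E : Type*} [NormedAddCommGroup E] [InnerProductSpace ℝ E] [CompleteSpace E]

/-- **W2's shape, GLOBAL.**  `φ` differentiable with `Dφ(x)[A (x − x₀)] − A (φ x) = 0` for all `x` (the conclusion of
`UnthreadedRigidity` for one slice) is equivariant under the one-parameter group `{exp (s • A)}` acting about `x₀`:
`φ (x₀ + exp (s • A) (x − x₀)) = exp (s • A) (φ x)`.  This is `RigidMotionDoorRigidFlow.apply_flow_eq_of_fderiv` BY NAME with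
`c = −x₀`, `e₂ = 0` (no skewness needed). [folklore] -/
theorem map_exp_smul_centre_of_fderiv (A : E →L[ℝ] E) (x₀ : E) {φ : E → E} (hφ : Differentiable ℝ φ)
    (h : ∀ x, fderiv ℝ φ x (A (x - x₀)) - A (φ x) = 0) (s : ℝ) (x : E) :
    φ (x₀ + exp (s • A) (x - x₀)) = exp (s • A) (φ x) := by
  have hsym : ∀ y, fderiv ℝ φ y (A y + (A (-x₀) + 0)) = A (φ y) := fun y => by
    rw [add_zero, ← map_add, ← sub_eq_add_neg]
    exact sub_eq_zero.1 (h y)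
  have key := apply_flow_eq_of_fderiv A (-x₀) (map_zero A) hφ hsym s x
  rw [← key]
  congr 1
  rw [smul_zero, add_zero, map_neg, sub_neg_eq_add, map_sub]
  abel

/-- **W2's shape, LOCAL about `x₀`** (skew `A`): `φ` differentiable on `{y | ‖y − x₀‖ ∈ T}` (`T` open: ball, shell, exterior,
punctured space about `x₀`) with `Dφ(y)[A (y − x₀)] = A (φ y)` there ⇒ `φ (x₀ + exp (s • A) (x − x₀)) = exp (s • A) (φ x)` for
`‖x − x₀‖ ∈ T` and all `s` (the flow `y ↦ x₀ + exp (s • A) (y − x₀)` preserves the set). [folklore] -/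
theorem map_exp_smul_centre_of_fderivOn {A : E →L[ℝ] E} (hA : ∀ x, ⟪A x, x⟫ = 0) (x₀ : E) {T : Set ℝ}
    (hT : IsOpen T) {φ : E → E} (hφ : DifferentiableOn ℝ φ {y : E | ‖y - x₀‖ ∈ T})
    (h : ∀ y : E, ‖y - x₀‖ ∈ T → fderiv ℝ φ y (A (y - x₀)) = A (φ y)) {x : E} (hx : ‖x - x₀‖ ∈ T) (s : ℝ) :
    φ (x₀ + exp (s • A) (x - x₀)) = exp (s • A) (φ x) := by
  have hUo : IsOpen {y : E | ‖y - x₀‖ ∈ T} := hT.preimage (continuous_id.sub continuous_const).norm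
  have hW : DifferentiableOn ℝ (fun z => φ (x₀ + z)) {z : E | ‖z‖ ∈ T} := fun z hz => by
    have hz' : x₀ + z ∈ {y : E | ‖y - x₀‖ ∈ T} := by simpa using hz
    exact (((hφ _ hz').differentiableAt (hUo.mem_nhds hz')).comp z
      ((differentiableAt_const x₀).add differentiableAt_id)).differentiableWithinAt
  have hcomm : ∀ z : E, ‖z‖ ∈ T → fderiv ℝ (fun z => φ (x₀ + z)) z (A z) = A (φ (x₀ + z)) := fun z hz => by
    rw [fderiv_comp_add_left]
    simpa using h (x₀ + z) (by simpa using hz)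
  have key := apply_exp_smul_of_fderivOn_comm_of_norm_mem hA hT hW hcomm (x := x - x₀) hx s
  simpa using key

end Centre

/-! ### §3′ On `ℝ³`: the integrated `IsAxisymmetric` in adapted coordinates, and the headline under `UnthreadedRigidity` -/

/-- **Bridge to the tree's integrated vocabulary.**  For a skew `A ≠ 0` of `ℝ³` and a differentiable `φ` with
`Dφ(x)[A (x − x₀)] − A (φ x) = 0` for all `x`, there are a linear isometry `L` and `α ≠ 0` with `L A L⁻¹ = α J`
(`J = rotGen`), and the transported field `z ↦ L (φ (L⁻¹ z + x₀))` is `IsAxisymmetric` (integrated sense) — the three lemmas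
`exists_conj_eq_smul_rotGen`, `fderiv_normalised_rotGen`, `isAxisymmetric_of_fderiv_rotGen` of the `AxisymEndLiouville` line,
composed for a bare differentiable slice (no class). [folklore] -/
theorem exists_isAxisymmetric_conj_of_fderiv {A : E3 →L[ℝ] E3} (hA : ∀ x, ⟪A x, x⟫ = 0) (hA0 : A ≠ 0) (x₀ : E3)
    {φ : E3 → E3} (hφ : Differentiable ℝ φ) (h : ∀ x, fderiv ℝ φ x (A (x - x₀)) - A (φ x) = 0) :
    ∃ L : E3 ≃ₗᵢ[ℝ] E3, ∃ α : ℝ, α ≠ 0 ∧ (∀ y, L (A (L.symm y)) = α • rotGen y) ∧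
      IsAxisymmetric (fun z => L (φ (L.symm z + x₀))) := by
  obtain ⟨L, α, hα, hconj⟩ := exists_conj_eq_smul_rotGen hA hA0
  refine ⟨L, α, hα, hconj, ?_⟩
  have hL : Differentiable ℝ (fun y : E3 => L y) := by
    simpa using L.toContinuousLinearEquiv.differentiable
  have hLs : Differentiable ℝ (fun y : E3 => L.symm y) := by
    simpa using L.symm.toContinuousLinearEquiv.differentiable
  have hd : Differentiable ℝ (fun z => L (φ (L.symm z + x₀))) :=
    hL.comp (hφ.comp (hLs.add_const x₀))
  exact isAxisymmetric_of_fderiv_rotGen hd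
    (fderiv_normalised_rotGen hφ L hα hconj x₀ fun x => sub_eq_zero.1 (h x))

/-- **HEADLINE — W2's one axis as an honest one-parameter rotation symmetry.**  ASSUMING `UnthreadedRigidity` (stmt-27585,
OPEN; taken by name as a hypothesis): for every window datum of W2 — `S` open preconnected, `u` continuous, divergence free,
Oseen-mild on `S`, bounded on sub-windows, UNTHREADED about `x₀` — whose slices are differentiable, there is a skew `A ≠ 0`
such that EVERY slice `u t`, `t ∈ S`, is equivariant under the one-parameter group `x ↦ x₀ + exp (s • A) (x − x₀)`, `s ∈ ℝ`,
of linear isometries fixing a non-zero axis vector `w` (`A w = 0`, `exp (s • A) w = w`).  Conditional glue; W2 OPEN. [folklore] -/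
theorem exp_smul_equivariant_of_unthreadedRigidity
    (hR : Summit.NavierStokesRegularity.NavierStokesRegularity.Theses.UnthreadedRigidityDoor.UnthreadedRigidity)
    (S : Set ℝ) (hS : IsOpen S) (hSc : IsPreconnected S) (u : ℝ → E3 → E3) (x₀ : E3)
    (hcont : ContinuousOn (Function.uncurry u) (S ×ˢ Set.univ))
    (hdiv : ∀ t ∈ S, VectorCalculus.IsDivFree (u t))
    (hmild : ∀ s ∈ S, ∀ t ∈ S, s < t → ∀ x, u t x =
      Literature.Analysis.UnboundedOperators.heatExtension (u s) (t - s) x - oseenDuhamel 1 s u u t x)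
    (hbdd : ∀ τ ∈ S, ∃ B : ℝ, ∀ t ∈ S, t ≤ τ → ∀ x, ‖u t x‖ ≤ B)
    (hunthr : ∀ t ∈ S, ∀ x, ⟪curl (u t) x, x - x₀⟫ = 0)
    (hdiff : ∀ t ∈ S, Differentiable ℝ (u t)) :
    ∃ A : E3 →L[ℝ] E3, (∀ x, ⟪A x, x⟫ = 0) ∧ A ≠ 0 ∧
      (∀ t ∈ S, ∀ (s : ℝ) (x : E3), u t (x₀ + exp (s • A) (x - x₀)) = exp (s • A) (u t x)) ∧
      (∀ (s : ℝ) (y : E3), ‖exp (s • A) y‖ = ‖y‖) ∧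
      ∃ w : E3, w ≠ 0 ∧ A w = 0 ∧ ∀ s : ℝ, exp (s • A) w = w := by
  obtain ⟨A, hskew, hA0, hsym⟩ := hR S hS hSc u x₀ hcont hdiv hmild hbdd hunthr
  obtain ⟨w, hw, hAw⟩ := exists_ne_zero_map_eq_zero_of_skew hskew hA0
  exact ⟨A, hskew, hA0, fun t ht s x => map_exp_smul_centre_of_fderiv A x₀ (hdiff t ht) (hsym t ht) s x,
    fun s y => norm_exp_smul_apply_of_inner_self_eq_zero hskew s y,
    w, hw, hAw, fun s => exp_smul_apply_of_map_eq_zero A hAw s⟩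

/-- The card's form (`ThreadingFluxPlatonicDefs.IsEquivariant`, centre `0`): a differentiable field with `DW(x)[A x] = A (W x)`
for all `x` is `IsEquivariant` under the set of maps `{exp (t • A) | t ∈ ℝ}`. [folklore] -/
theorem isEquivariant_range_exp_smul_of_fderiv_comm (A : E3 →L[ℝ] E3) {W : E3 → E3} (hW : Differentiable ℝ W)
    (hcomm : ∀ x, fderiv ℝ W x (A x) = A (W x)) :
    IsEquivariant (Set.range fun t : ℝ => fun x : E3 => exp (t • A) x) W := by
  rintro g ⟨t, rfl⟩ x
  exact apply_exp_smul_of_fderiv_comm A hW hcomm t x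

/-- The card's AXIAL form (p722437 `ThreadingFluxPlatonicSymmetryAlgebra` vocabulary): `DW(x)[c × x] = c × W(x)` for all `x`
makes a differentiable `W` equivariant under the one-parameter group `{exp (t • (c × ·))}` generated by the cross product
with `c` (`crossCLM c`; for a unit `c` these are the rotations about the axis `ℝ c`). [folklore] -/
theorem isEquivariant_range_exp_smul_crossCLM_of_fderiv_cross (c : E3) {W : E3 → E3} (hW : Differentiable ℝ W)
    (hc : ∀ x, fderiv ℝ W x (cross c x) = cross c (W x)) :
    IsEquivariant (Set.range fun t : ℝ => fun x : E3 => exp (t • crossCLM c) x) W :=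
  isEquivariant_range_exp_smul_of_fderiv_comm (crossCLM c) hW fun x => by simpa using hc x

end Summit.NavierStokesRegularity.NavierStokesRegularity.Theorems.PoloidalLiouville.Platonic

end
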